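import Mathlib.Data.ZMod.Basic
import Mathlib.Algebra.Group.Subgroup.Defs
import Mathlib.Data.Fintype.Prod
import Mathlib.Data.Nat.Bitwise
import HarnessLib

/-!
# (2,1,1)¹⁰ ⊄ (ℤ/2)⁶ — part A: codes of `𝔽₂⁶` and the coordinate hyperplanes (kernel-checked bridge)

Cell `pub-omega` (unit `pub-omega-stpp-1-g36`), topic `Summits/MatrixMultiplication/OmegaCensus`.
HONEST FRAMING (verbatim): lottery ticket; floor = certified bounds/negative ranges. Census STRUCTURE bookkeeping (B5, the threshold
column `T1(H) = max {k : (2,1,1)^k ⊆ H}` at the elementary type `(ℤ/2)⁶`, Pb237); nothing here is a bound on `ω`.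

* `G6 = (ℤ/2)⁶` right-nested as in the census statements; the 6-bit code `enc : G6 → ℕ` (first coordinate = bit 5), additive for
  `Nat.xor`, injective, `< 64`, with inverse `dec` on `[0, 64)`.
* `Wb b` — the COORDINATE HYPERPLANE «bit `b` of the code is `0`» (`b < 6`) as an `AddSubgroup G6`, with the index-2 law
  `sub_mem_Wb_of_not_mem` (two elements outside `Wb b` differ by an element of `Wb b`).
Twin of `STPP211Z2pow5Codes` (seat g35) one dimension up; used by the COSET-LAW certificates for the 10-point `c`-sets of `𝔽₂⁶`.

References: H. Cohn, R. Kleinberg, B. Szegedy, C. Umans, FOCS 2005 (arXiv:math/0511460), Def. 5.1.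
-/

namespace Summit.MatrixMultiplication.OmegaCensus

namespace T1Z2p6

open Finset

/-! ## Codes -/

/-- The group `𝔽₂⁶`, right-nested as in the census statements. -/
abbrev G6 : Type := ZMod 2 × ZMod 2 × ZMod 2 × ZMod 2 × ZMod 2 × ZMod 2

/-- The 6-bit code of an element (first coordinate = bit 5). -/
def enc (x : G6) : ℕ :=
  32 * x.1.val + (16 * x.2.1.val + (8 * x.2.2.1.val + (4 * x.2.2.2.1.val + (2 * x.2.2.2.2.1.val + x.2.2.2.2.2.val))))

/-- The element with a given code (`n < 64`). -/
def dec (n : ℕ) : G6 :=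
  (((n / 32 % 2 : ℕ) : ZMod 2), ((n / 16 % 2 : ℕ) : ZMod 2), ((n / 8 % 2 : ℕ) : ZMod 2), ((n / 4 % 2 : ℕ) : ZMod 2),
    ((n / 2 % 2 : ℕ) : ZMod 2), ((n % 2 : ℕ) : ZMod 2))

/-- Codes are `< 64`. -/
theorem enc_lt (x : G6) : enc x < 64 := by revert x; decide

/-- `dec` inverts `enc`. -/
theorem dec_enc (x : G6) : dec (enc x) = x := by revert x; decide

/-- `enc` inverts `dec` on `[0, 64)`. -/
theorem enc_dec : ∀ n < 64, enc (dec n) = n := by decide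

/-- `enc` is injective. -/
theorem enc_injective : Function.Injective enc := fun x y h => by rw [← dec_enc x, h, dec_enc]

/-- `enc 0 = 0`. -/
theorem enc_zero : enc 0 = 0 := by decide

/-- In `𝔽₂⁶` every element is its own negative. -/
theorem neg_eq_self6 : ∀ x : G6, -x = x := by decide

/-- In `𝔽₂⁶` subtraction is addition. -/
theorem sub_eq_add6 (x y : G6) : x - y = x + y := by rw [sub_eq_add_neg, neg_eq_self6]

/-- All codes `< 64` satisfy a Boolean test. -/
def allC (f : ℕ → Bool) : Bool := (List.range 64).all f

/-- Reading a passed `allC` test. -/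
theorem allC_spec {f : ℕ → Bool} (h : allC f = true) {x : ℕ} (hx : x < 64) : f x = true :=
  List.all_eq_true.1 h x (List.mem_range.2 hx)

/-- Kernel check: `enc` turns addition into XOR of codes (over `dec`, all `64 · 64` pairs). -/
theorem enc_add_check : (allC fun a => allC fun b => Nat.beq (enc (dec a + dec b)) (Nat.xor a b)) = true := by
  decide +kernel

/-- **Addition is XOR of codes.** -/
theorem enc_add (x y : G6) : enc (x + y) = Nat.xor (enc x) (enc y) := by
  have h := allC_spec (allC_spec enc_add_check (enc_lt x)) (enc_lt y)
  rw [dec_enc, dec_enc] at h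
  exact Nat.eq_of_beq_eq_true h

/-- Subtraction is XOR of codes. -/
theorem enc_sub (x y : G6) : enc (x - y) = Nat.xor (enc x) (enc y) := by rw [sub_eq_add6, enc_add]

/-! ## The coordinate hyperplanes -/

/-- Kernel check behind `Wb`: bit `b` of a XOR (codes `< 64`, `b < 6`). -/
theorem testBit_xor_check : ((List.range 6).all fun b => allC fun x => allC fun y =>
    (Nat.xor x y).testBit b == (x.testBit b != y.testBit b)) = true := by
  decide +kernel

/-- Bit `b < 6` of the XOR of two codes. -/
theorem testBit_xor6 {b x y : ℕ} (hb : b < 6) (hx : x < 64) (hy : y < 64) :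
    (Nat.xor x y).testBit b = (x.testBit b != y.testBit b) := by
  have h := allC_spec (allC_spec (List.all_eq_true.1 testBit_xor_check b (List.mem_range.2 hb)) hx) hy
  exact (beq_iff_eq).1 h

/-- **The coordinate hyperplane** `Wb b = {x : bit b of enc x is 0}` (`b < 6`), an index-2 subgroup of `𝔽₂⁶`. -/
def Wb (b : Fin 6) : AddSubgroup G6 where
  carrier := {x | (enc x).testBit b = false}
  add_mem' := by
    intro x y hx hy
    simp only [Set.mem_setOf_eq] at hx hy ⊢
    rw [enc_add, testBit_xor6 b.isLt (enc_lt x) (enc_lt y), hx, hy]; rfl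
  zero_mem' := by
    show (enc 0).testBit b = false
    rw [enc_zero, Nat.zero_testBit]
  neg_mem' := by
    intro x hx
    simp only [Set.mem_setOf_eq] at hx ⊢
    rwa [neg_eq_self6]

/-- Membership in `Wb b` is the bit test. -/
theorem mem_Wb {b : Fin 6} {x : G6} : x ∈ Wb b ↔ (enc x).testBit b = false := Iff.rfl

/-- Membership in `Wb b` is decidable (by the bit test). -/
instance decMemWb (b : Fin 6) : DecidablePred (· ∈ Wb b) := fun x => decidable_of_iff _ (mem_Wb (b := b) (x := x)).symm

/-- **Index 2:** two elements outside `Wb b` differ by an element of `Wb b`. -/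
theorem sub_mem_Wb_of_not_mem {b : Fin 6} {x y : G6} (hx : x ∉ Wb b) (hy : y ∉ Wb b) : x - y ∈ Wb b := by
  rw [mem_Wb] at hx hy ⊢
  rw [Bool.not_eq_false] at hx hy
  rw [enc_sub, testBit_xor6 b.isLt (enc_lt x) (enc_lt y), hx, hy]; rfl

/-- Translating by an element of `Wb b` keeps membership (difference form). -/
theorem sub_mem_Wb_iff {b : Fin 6} {x g : G6} (hg : g ∈ Wb b) : x - g ∈ Wb b ↔ x ∈ Wb b := by
  rw [mem_Wb, mem_Wb, enc_sub, testBit_xor6 b.isLt (enc_lt x) (enc_lt g), mem_Wb.1 hg]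
  cases (enc x).testBit b <;> simp

end T1Z2p6

end Summit.MatrixMultiplication.OmegaCensus
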